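import Mathlib
import HarnessLib
import Summits.ValiantsHypothesis.ValiantsHypothesis.Theorems.LacunarySymmetroidMatrixDescartesProductPlusOneSeparatingWeightUpperSigned

/-!
# ValiantsHypothesis / LacunarySymmetroid — crux `MatrixDescartes` (stmt-ValiantsHypothesis-18050, V1),
# LINE (A) «product_plus_one»: the mean-ordered sector at the TOP coupling (every `K`) — the mirror twin

Mirror of ✓ `sepWeight_meanOrdered_upperSigned_le` (bottom coupling).  At the TOP coupling (`d l < d l₀` for `l ≠ l₀`) the open cross
term of the pair ✓ `eulerBoundPoly_lowerSignedK` (bottom) / ✓ `eulerBoundPoly_upperSignedK` (top) is the company of rows with a positive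
TOP letter and negative lower letters, `a_{j l₀} > 0`, `a_{jl} < 0` (`l ≠ l₀`) — one sign change at the top.  Their stripped rows
`B_j = Σ_l (d_l − d_{l₀}) a_{jl} x^{d_l}` are POSITIVE, they are negative for small `x` («unswitched», puller-like: `f·B < 0`) and positive
after their zero («switched», riser-like), and the mean-pivot law ✓ `sepWeight_meanPivot_eulerNumerator_le` applies verbatim with the
tilted means `B⁽²⁾_j/B_j` (now negative numbers):

* `sepWeight_topSigned_strippedRow_pos`, `sepWeight_topSigned_pos_roots_le_one`, `sepWeight_topSigned_prod` — sign of the stripped row,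
  Descartes (`≤ 1` positive zero per row, top-extreme form of ✓ `countP_pos_roots_le_one_of_extreme`), `P ≠ 0`, `Z₊(P) ≤ m`;
* ★★★ `sepWeight_meanOrdered_topSigned_le` — EVERY `K`, every support, TOP coupling: if at every `x > 0` every switched row (`f_j > 0`)
  has tilted mean at most that of every unswitched row (`f_i < 0`), division-free `B⁽²⁾_j·B_i ≤ B⁽²⁾_i·B_j`, then
  `Z₊(eulerNumerator d a l₀) ≤ m + (m + 1)`.

HONEST FRAMING: sector/helper theorems for the research stubs `stub_eulerBoundK3` (top coupling) / `stub_polyLaw`; NOT those stubs, not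
`MatrixDescartes`; `VP ≠ VNP` is NOT proved.  No definitions, no named facts, no sorry.
-/

set_option linter.dupNamespace false

namespace Summit.ValiantsHypothesis.ValiantsHypothesis.Theorems.LacunarySymmetroidMatrixDescartes

namespace ProductPlusOne

open Polynomial Finset
open scoped BigOperators

/-- at the top coupling the stripped row of a top-signed row (`a_{l₀} > 0 > a_l`) is POSITIVE on `(0,∞)`. [this file's lemma] -/
theorem sepWeight_topSigned_strippedRow_pos {m K : ℕ} (d : Fin K → ℕ) (a : Fin m → Fin K → ℝ) (l₀ : Fin K)
    (hd : ∀ l, l ≠ l₀ → d l < d l₀) (hK : ∃ l : Fin K, l ≠ l₀)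
    (hup : ∀ j, 0 < a j l₀ ∧ ∀ l, l ≠ l₀ → a j l < 0) (j : Fin m) {z : ℝ} (hz : 0 < z) :
    0 < (∑ l, ((d l : ℝ) - d l₀) * a j l * z ^ (d l)) := by
  classical
  obtain ⟨l₁, hl₁⟩ := hK
  have hterm : ∀ l ∈ Finset.univ.erase l₁, 0 ≤ ((d l : ℝ) - d l₀) * a j l * z ^ (d l) := by
    intro l _
    by_cases hl : l = l₀
    · subst hl; simp
    · have h1 : (d l : ℝ) - d l₀ < 0 := sub_neg.mpr (by exact_mod_cast hd l hl)
      exact (mul_pos (mul_pos_of_neg_of_neg h1 ((hup j).2 l hl)) (by positivity)).le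
  have hlt : 0 < ((d l₁ : ℝ) - d l₀) * a j l₁ * z ^ (d l₁) := by
    have h1 : (d l₁ : ℝ) - d l₀ < 0 := sub_neg.mpr (by exact_mod_cast hd l₁ hl₁)
    exact mul_pos (mul_pos_of_neg_of_neg h1 ((hup j).2 l₁ hl₁)) (by positivity)
  rw [← Finset.sum_erase_add _ _ (Finset.mem_univ l₁)]
  have := Finset.sum_nonneg hterm
  linarith

/-- **Descartes at the top**: a top-signed row has at most ONE positive zero. [this file's lemma] -/
theorem sepWeight_topSigned_pos_roots_le_one {K : ℕ} (d : Fin K → ℕ) (b : Fin K → ℝ) (l₀ : Fin K)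
    (hd : ∀ l, l ≠ l₀ → d l < d l₀) (hb : 0 < b l₀ ∧ ∀ l, l ≠ l₀ → b l < 0) :
    ((∑ l, C (b l) * X ^ (d l) : ℝ[X]).roots.toFinset.filter (fun t => 0 < t)).card ≤ 1 := by
  classical
  rw [← roots_neg]
  refine (StubVLawTwo.card_filter_pos_le_countP _).trans
    (countP_pos_roots_le_one_of_extreme _ (d l₀) (fun i hi => ?_) (Or.inr (fun i hi => ?_)))
  · rw [coeff_neg, sepWeight_coeff_fewnomial, ← Finset.sum_neg_distrib]
    refine Finset.sum_nonneg (fun l _ => ?_)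
    split_ifs with h
    · have hl : l ≠ l₀ := fun hl => hi (by rw [h, hl])
      have := hb.2 l hl
      linarith
    · simp
  · rw [coeff_neg, sepWeight_coeff_fewnomial, neg_eq_zero]
    refine Finset.sum_eq_zero (fun l _ => ?_)
    rw [if_neg]
    intro h
    by_cases hl : l = l₀
    · subst hl; omega
    · have := hd l hl; omega

/-- **The product of top-signed rows**: non-zero, with at most `m` positive zeros. [this file's lemma] -/
theorem sepWeight_topSigned_prod {m K : ℕ} (d : Fin K → ℕ) (a : Fin m → Fin K → ℝ) (l₀ : Fin K)
    (hd : ∀ l, l ≠ l₀ → d l < d l₀) (hup : ∀ j, 0 < a j l₀ ∧ ∀ l, l ≠ l₀ → a j l < 0) :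
    (∏ j, ∑ l, C (a j l) * X ^ (d l) : ℝ[X]) ≠ 0 ∧ ((∏ j, ∑ l, C (a j l) * X ^ (d l) : ℝ[X]).roots.toFinset.filter (fun t => 0 < t)).card ≤ m := by
  classical
  have hne : ∀ j, (∑ l, C (a j l) * X ^ (d l) : ℝ[X]) ≠ 0 := by
    intro j h0
    have h := congrArg (fun q : ℝ[X] => q.coeff (d l₀)) h0
    simp only [sepWeight_coeff_fewnomial, coeff_zero] at h
    rw [Finset.sum_eq_single l₀ (fun l _ hl => if_neg (fun h' => absurd h' (ne_of_gt (hd l hl))))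
      (fun h' => absurd (Finset.mem_univ _) h'), if_pos rfl] at h
    exact (hup j).1.ne' h
  have hP0 : (∏ j, ∑ l, C (a j l) * X ^ (d l) : ℝ[X]) ≠ 0 := Finset.prod_ne_zero_iff.mpr (fun j _ => hne j)
  refine ⟨hP0, ?_⟩
  have hsub : ((∏ j, ∑ l, C (a j l) * X ^ (d l) : ℝ[X]).roots.toFinset.filter (fun t => 0 < t)) ⊆ Finset.univ.biUnion (fun j =>
        ((∑ l, C (a j l) * X ^ (d l) : ℝ[X]).roots.toFinset.filter (fun t => 0 < t))) := by
    intro x hx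
    rw [mem_filter, Multiset.mem_toFinset, mem_roots hP0, IsRoot.def, eval_prod, Finset.prod_eq_zero_iff] at hx
    obtain ⟨⟨j, _, hj⟩, hx0⟩ := hx
    rw [mem_biUnion]
    refine ⟨j, mem_univ _, ?_⟩
    rw [mem_filter, Multiset.mem_toFinset, mem_roots (hne j), IsRoot.def]
    exact ⟨hj, hx0⟩
  refine (card_le_card hsub).trans (card_biUnion_le.trans ?_)
  calc ∑ j, (((∑ l, C (a j l) * X ^ (d l) : ℝ[X]).roots.toFinset.filter (fun t => 0 < t))).card
      ≤ ∑ _j : Fin m, 1 :=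
        Finset.sum_le_sum (fun j _ => sepWeight_topSigned_pos_roots_le_one d (a j) l₀ hd (hup j))
    _ = m := by simp

/-- ★★★ **THE MEAN-ORDERED SECTOR AT THE TOP COUPLING, EVERY `K`** (`d l < d l₀` for `l ≠ l₀`, some `l ≠ l₀`; rows `a_{j l₀} > 0`,
`a_{jl} < 0` otherwise): if at every `x > 0`, for every switched row `j` (`f_j(x) > 0`) and every unswitched row `i` (`f_i(x) < 0`),
`B⁽²⁾_j(x)·B_i(x) ≤ B⁽²⁾_i(x)·B_j(x)` (both `B` positive: `B⁽²⁾_j/B_j ≤ B⁽²⁾_i/B_i`), then `Z₊(eulerNumerator d a l₀) ≤ m + (m + 1)`.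
[this file's theorem] -/
theorem sepWeight_meanOrdered_topSigned_le {m K : ℕ} (d : Fin K → ℕ) (a : Fin m → Fin K → ℝ) (l₀ : Fin K)
    (hd : ∀ l, l ≠ l₀ → d l < d l₀) (hK : ∃ l : Fin K, l ≠ l₀)
    (hup : ∀ j, 0 < a j l₀ ∧ ∀ l, l ≠ l₀ → a j l < 0)
    (hord : ∀ z : ℝ, 0 < z → ∀ j i, 0 < (∑ l, a j l * z ^ (d l)) → (∑ l, a i l * z ^ (d l)) < 0 → (∑ l, ((d l : ℝ) - d l₀) ^ 2 * a j l * z ^ (d l)) * (∑ l, ((d l : ℝ) - d l₀) * a i l * z ^ (d l)) ≤ (∑ l, ((d l : ℝ) - d l₀) ^ 2 * a i l * z ^ (d l)) * (∑ l, ((d l : ℝ) - d l₀) * a j l * z ^ (d l))) :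
    ((∑ j, (∑ l, C (a j l * ((d l : ℝ) - d l₀)) * X ^ (d l)) * ∏ i ∈ Finset.univ.erase j, (∑ l, C (a i l) * X ^ (d l)) : ℝ[X]).roots.toFinset.filter (fun t => 0 < t)).card ≤ m + (m + 1) := by
  classical
  obtain ⟨hP0, hZ⟩ := sepWeight_topSigned_prod d a l₀ hd hup
  refine sepWeight_meanPivot_eulerNumerator_le d a l₀ hP0 m hZ (fun z hz hg _hEz => ?_)
  have hBpos : ∀ j, 0 < (∑ l, ((d l : ℝ) - d l₀) * a j l * z ^ (d l)) := fun j => sepWeight_topSigned_strippedRow_pos d a l₀ hd hK hup j hz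
  -- switched rows at `z` (here: `f_j > 0`)
  set S : Finset (Fin m) := Finset.univ.filter (fun j => 0 < (∑ l, a j l * z ^ (d l))) with hS
  by_cases hSne : S.Nonempty
  · -- pivot = the LARGEST tilted mean among the switched rows
    obtain ⟨j₀, hj₀, hmax⟩ := S.exists_max_image (fun j => (∑ l, ((d l : ℝ) - d l₀) ^ 2 * a j l * z ^ (d l)) / (∑ l, ((d l : ℝ) - d l₀) * a j l * z ^ (d l))) hSne
    have hj₀' : 0 < (∑ l, a j₀ l * z ^ (d l)) := (Finset.mem_filter.mp hj₀).2
    have hB0 := hBpos j₀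
    refine ⟨(∑ l, ((d l : ℝ) - d l₀) ^ 2 * a j₀ l * z ^ (d l)) / (∑ l, ((d l : ℝ) - d l₀) * a j₀ l * z ^ (d l)), fun j => ⟨?_, (hBpos j).ne'⟩⟩
    have hBj := hBpos j
    rcases lt_or_gt_of_ne (hg j) with hlt | hgt
    · -- unswitched (`f_j < 0`): pivot ≤ mean_j, i.e. `μ·B_j ≤ B2_j`
      have hle : (∑ l, ((d l : ℝ) - d l₀) ^ 2 * a j₀ l * z ^ (d l)) * (∑ l, ((d l : ℝ) - d l₀) * a j l * z ^ (d l)) ≤ (∑ l, ((d l : ℝ) - d l₀) ^ 2 * a j l * z ^ (d l)) * (∑ l, ((d l : ℝ) - d l₀) * a j₀ l * z ^ (d l)) := hord z hz j₀ j hj₀' hlt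
      have h1 : (∑ l, ((d l : ℝ) - d l₀) ^ 2 * a j₀ l * z ^ (d l)) / (∑ l, ((d l : ℝ) - d l₀) * a j₀ l * z ^ (d l)) * (∑ l, ((d l : ℝ) - d l₀) * a j l * z ^ (d l)) ≤ (∑ l, ((d l : ℝ) - d l₀) ^ 2 * a j l * z ^ (d l)) := by
        rw [div_mul_eq_mul_div, div_le_iff₀ hB0]
        exact hle
      nlinarith
    · -- switched (`f_j > 0`): mean_j ≤ pivot, i.e. `B2_j ≤ μ·B_j`
      have hle : (∑ l, ((d l : ℝ) - d l₀) ^ 2 * a j l * z ^ (d l)) / (∑ l, ((d l : ℝ) - d l₀) * a j l * z ^ (d l)) ≤ (∑ l, ((d l : ℝ) - d l₀) ^ 2 * a j₀ l * z ^ (d l)) / (∑ l, ((d l : ℝ) - d l₀) * a j₀ l * z ^ (d l)) := hmax j (Finset.mem_filter.mpr ⟨Finset.mem_univ _, hgt⟩)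
      have h1 : (∑ l, ((d l : ℝ) - d l₀) ^ 2 * a j l * z ^ (d l)) ≤ (∑ l, ((d l : ℝ) - d l₀) ^ 2 * a j₀ l * z ^ (d l)) / (∑ l, ((d l : ℝ) - d l₀) * a j₀ l * z ^ (d l)) * (∑ l, ((d l : ℝ) - d l₀) * a j l * z ^ (d l)) := (div_le_iff₀ hBj).mp hle
      nlinarith
  · -- no switched row: pivot = the SMALLEST tilted mean
    rcases Nat.eq_zero_or_pos m with hm | hm
    · subst hm
      exact ⟨0, fun j => j.elim0⟩
    obtain ⟨j₁, -, hmin⟩ := Finset.univ.exists_min_image (fun j => (∑ l, ((d l : ℝ) - d l₀) ^ 2 * a j l * z ^ (d l)) / (∑ l, ((d l : ℝ) - d l₀) * a j l * z ^ (d l))) ⟨⟨0, hm⟩, Finset.mem_univ _⟩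
    refine ⟨(∑ l, ((d l : ℝ) - d l₀) ^ 2 * a j₁ l * z ^ (d l)) / (∑ l, ((d l : ℝ) - d l₀) * a j₁ l * z ^ (d l)), fun j => ⟨?_, (hBpos j).ne'⟩⟩
    have hBj := hBpos j
    have hlt : (∑ l, a j l * z ^ (d l)) < 0 := by
      rcases lt_or_gt_of_ne (hg j) with hlt | hgt
      · exact hlt
      · exact absurd ⟨j, Finset.mem_filter.mpr ⟨Finset.mem_univ _, hgt⟩⟩ hSne
    have hle : (∑ l, ((d l : ℝ) - d l₀) ^ 2 * a j₁ l * z ^ (d l)) / (∑ l, ((d l : ℝ) - d l₀) * a j₁ l * z ^ (d l)) ≤ (∑ l, ((d l : ℝ) - d l₀) ^ 2 * a j l * z ^ (d l)) / (∑ l, ((d l : ℝ) - d l₀) * a j l * z ^ (d l)) := hmin j (Finset.mem_univ _)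
    have h1 : (∑ l, ((d l : ℝ) - d l₀) ^ 2 * a j₁ l * z ^ (d l)) / (∑ l, ((d l : ℝ) - d l₀) * a j₁ l * z ^ (d l)) * (∑ l, ((d l : ℝ) - d l₀) * a j l * z ^ (d l)) ≤ (∑ l, ((d l : ℝ) - d l₀) ^ 2 * a j l * z ^ (d l)) := (le_div_iff₀ hBj).mp hle
    nlinarith

end ProductPlusOne

end Summit.ValiantsHypothesis.ValiantsHypothesis.Theorems.LacunarySymmetroidMatrixDescartes
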